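import Summits.Ventures.WeilGRH.TwistedWindowSectors
import Summits.RiemannHypothesis.RiemannHypothesis.Theorems.WeilFormatCEntryGram
import HarnessLib

/-!
# GRH arm (rh-explicit, venture WeilGRH): the Gram matrix of an EVEN character with COMPLEX values on
  Yoshida's windows — the shift-pairing entries, the entry theorem, the certificate interface

Cell `rh-explicit`, WEIL TRACK — GRH ARM (typing seat weil-grh-1).  Sequel of `TwistedGramEvenReal.lean` for
characters `χ` of EVEN parity (`a_χ = 0`: the archimedean density of `ζ`) and arbitrary (complex) values
— the 24 even non-real primitive characters of conductor `≤ 20` (`7.2/7.4`, `9.4/9.7`, `11.3`, `13.3/13.4`, …).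

The twisted jump at the length `t = log k` reads, for every bounded measurable `u` vanishing off `[-a,a]`,
`D^ω_t(u) = (1 + |ω|²)‖u‖₂² − 2 Re(ω̄ · h_u(t))`, `h_u(t) = ∫ u(x+t) conj u(x) dx`
(`weilTwistIncrement_eq_of_window`), so the twisted window form is the `ζ` one without pole, shifted by
`log q`, plus a TWISTED SHIFT PAIRING:

  `𝓔^χ_a(u) − M^χ_a‖u‖₂² = [weilWindowForm a u − P(u)] + 2 Σ_{log k<2a} Λ(k)k^{-1/2} Re((1 − χ(k)) h_u(log k)) + (log q)‖u‖₂²`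

(`twistedWindowForm_eq_of_even`; for real `χ` this is `TwistedGramEvenReal.twistedWindowForm_eq_of_even_real`,
since `2Re h_u = 2‖u‖₂² − D_t(u)`).  On Yoshida's basis the shift pairing has the closed form
`P_t(m,n) = ∫ χ_m(x+t) conj χ_n(x) dx = shiftCoeff a t m n` (`0 ≤ t ≤ 2a`; weil-2's
`integral_chi_shift_mul_conj_chi_self/_of_ne`: `e^{iω_n t}(2a − t)/(2a)` on the diagonal,
`(−1)^{n+m}(e^{iω_n t} − e^{iω_m t})/(2πi(m − n))` off it), whence the HERMITIAN Gram kernel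

  `twistedGramCoeffC χ a n m = (gramCoeff − polarCoeff)(n,m) + (log q)δ_{nm}`
     `+ Σ_{log k<2a} Λ(k)k^{-1/2} [(1 − χ(k))·P_{log k}(m,n) + conj((1 − χ(k))·P_{log k}(n,m))]`

and the ENTRY THEOREM `𝓔^χ_a(Σ c_nχ_n) − M^χ_a‖Σ c_nχ_n‖₂² = Σ_n Σ_m Re(conj c_n · c_m · twistedGramCoeffC χ a n m)`
(`twistedWindowForm_sum_smul_chi_eq_twistedGramCoeffC`); with the dictionary,
`weilPositivityOnChar_of_twistedGramCoeffC_psd`: hermitian PSD for every `N` ⟹ `WeilPositivityOnChar χ a`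
(`q ≠ 1`, `a > 0`, `a_χ = 0`).  A kernel-side certificate realifies the hermitian matrix (the cell's
«J-real (2N+1)-form»).  Two definitions (docstring'd); no named facts; RH/GRH-free.  Odd parity is not treated
(it needs the parity-1 archimedean coefficients).
-/

set_option autoImplicit false

noncomputable section

open Complex Filter Set MeasureTheory
open scoped Real Topology ComplexConjugate ArithmeticFunction.vonMangoldt

namespace Summit.Ventures.WeilGRH

open Literature.NumberTheory.LFunctions
open Literature.NumberTheory.LFunctions.Yoshida1992 (modes chi freq gramCoeff polarCoeff incrCoeff)
open Summit.RiemannHypothesis.RiemannHypothesis.Theorems.WeilFormatC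

variable {q : ℕ} {a S : ℝ} {u : ℝ → ℂ}

/-! ## Definitions -/

/-- **The shift pairing of Yoshida's basis on the window scale** (`0 ≤ t ≤ 2a`):
`P_t(m,n) = ∫ χ_m(x+t) conj χ_n(x) dx` in closed form — `e^{iω_n t}(2a − t)/(2a)` for `m = n`,
`(−1)^{n+m}(e^{iω_n t} − e^{iω_m t})/(2πi(m − n))` for `m ≠ n` (`ω_n = πn/a`; weil-2's
`integral_chi_shift_mul_conj_chi_self` / `_of_ne`, `shiftCoeff_eq_integral`). -/
def shiftCoeff (a t : ℝ) (m n : ℤ) : ℂ :=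
  if m = n then cexp (((π * n / a : ℝ) : ℂ) * t * I) * (((2 * a - t) / (2 * a) : ℝ) : ℂ)
  else (-1) ^ (n + m) * (cexp (((π * n / a : ℝ) : ℂ) * t * I) - cexp (((π * m / a : ℝ) : ℂ) * t * I)) /
    (((2 * π * (m - n) : ℝ) : ℂ) * I)

/-- **The hermitian Gram kernel of an even character on Yoshida's basis**:
`G^χ(n,m) = (gramCoeff − polarCoeff)(n,m) + (log q)δ_{nm} + Σ_{log k<2a} Λ(k)k^{-1/2}[(1 − χ(k))P_{log k}(m,n) + conj((1 − χ(k))P_{log k}(n,m))]`.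
It IS the matrix of the twisted window form for `a_χ = 0` (`twistedWindowForm_sum_smul_chi_eq_twistedGramCoeffC`);
for a real character its real part is `twistedGramCoeff` of `TwistedGramEvenReal.lean`. -/
def twistedGramCoeffC (χ : DirichletCharacter ℂ q) (a : ℝ) (n m : ℤ) : ℂ :=
  ((gramCoeff a n m - polarCoeff a n m + (if n = m then Real.log q else 0) : ℝ) : ℂ) +
    ∑ k ∈ weilPrimeIndex a, (((Λ k : ℝ) / Real.sqrt k : ℝ) : ℂ) *
      ((1 - χ (k : ZMod q)) * shiftCoeff a (Real.log k) m n +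
        conj ((1 - χ (k : ZMod q)) * shiftCoeff a (Real.log k) n m))

/-- **Hermitian symmetry**: `G^χ(m,n) = conj G^χ(n,m)`. -/
theorem twistedGramCoeffC_conj_symm (χ : DirichletCharacter ℂ q) (a : ℝ) (n m : ℤ) :
    twistedGramCoeffC χ a m n = conj (twistedGramCoeffC χ a n m) := by
  unfold twistedGramCoeffC
  rw [map_add, Complex.conj_ofReal, map_sum, Yoshida1992.gramCoeff_comm a m n,
    Yoshida1992.polarCoeff_comm a m n]
  have hδ : (if m = n then Real.log q else 0) = (if n = m then Real.log q else 0) := by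
    by_cases h : m = n
    · rw [if_pos h, if_pos h.symm]
    · rw [if_neg h, if_neg (Ne.symm h)]
  rw [hδ]
  congr 1
  refine Finset.sum_congr rfl fun k _ ↦ ?_
  simp only [map_mul, map_add, map_sub, map_one, Complex.conj_conj, Complex.conj_ofReal]
  ring

/-! ## The shift pairing -/

/-- `P_t(m,n)` is the closed form of `∫ χ_m(x+t) conj χ_n(x) dx` for `0 ≤ t ≤ 2a`. -/
theorem shiftCoeff_eq_integral (ha : 0 < a) (m n : ℤ) {t : ℝ} (ht0 : 0 ≤ t) (ht : t ≤ 2 * a) :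
    shiftCoeff a t m n = ∫ x, chi a m (x + t) * conj (chi a n x) := by
  unfold shiftCoeff
  by_cases h : m = n
  · subst h
    rw [if_pos rfl, integral_chi_shift_mul_conj_chi_self ha m ht0 ht]
  · rw [if_neg h, integral_chi_shift_mul_conj_chi_of_ne ha h ht0 ht]

/-- **The shift pairing of a trigonometric window** (`0 ≤ t ≤ 2a`):
`∫ u(x+t) conj u(x) dx = Σ_m Σ_n c_m conj(c_n) P_t(m,n)` for `u = Σ c_n χ_n`. -/
theorem integral_shift_mul_conj_sum_smul_chi (ha : 0 < a) (s : Finset ℤ) (c : ℤ → ℂ) {t : ℝ}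
    (ht0 : 0 ≤ t) (ht : t ≤ 2 * a) :
    ∫ x, (∑ n ∈ s, c n • chi a n) (x + t) * conj ((∑ n ∈ s, c n • chi a n) x) =
      ∑ m ∈ s, ∑ n ∈ s, c m * conj (c n) * shiftCoeff a t m n := by
  have hpt : ∀ x, (∑ n ∈ s, c n • chi a n) (x + t) * conj ((∑ n ∈ s, c n • chi a n) x) =
      ∑ m ∈ s, ∑ n ∈ s, c m * conj (c n) * (chi a m (x + t) * conj (chi a n x)) := by
    intro x
    rw [sum_smul_chi_apply, sum_smul_chi_apply, map_sum, Finset.sum_mul_sum]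
    refine Finset.sum_congr rfl fun m _ ↦ Finset.sum_congr rfl fun n _ ↦ ?_
    rw [map_mul]; ring
  simp_rw [hpt]
  rw [integral_finsetSum _ fun m _ ↦ integrable_finsetSum _ fun n _ ↦
    (integrable_chi_shift_mul_conj_chi m n ht0).const_mul _]
  refine Finset.sum_congr rfl fun m _ ↦ ?_
  rw [integral_finsetSum _ fun n _ ↦ (integrable_chi_shift_mul_conj_chi m n ht0).const_mul _]
  refine Finset.sum_congr rfl fun n _ ↦ ?_
  rw [integral_const_mul, shiftCoeff_eq_integral ha m n ht0 ht]

/-! ## Twisted increments of window functions through the shift pairing -/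

/-- A shifted window function times the conjugate of a window function is integrable. -/
private theorem integrable_shift_mul_conj (hm : Measurable u) (hz : ∀ x, x ∉ Icc (-a) a → u x = 0)
    (hb : ∀ x, ‖u x‖ ≤ S) (t : ℝ) : Integrable fun x ↦ u (x + t) * conj (u x) := by
  have hS : 0 ≤ S := (norm_nonneg _).trans (hb 0)
  have hint : Integrable fun x ↦ (Icc (-a) a).indicator (fun _ ↦ S * S) x :=
    (integrable_indicator_iff measurableSet_Icc).2 (integrableOn_const (by simp [Real.volume_Icc]))
  refine hint.mono' (((hm.comp (measurable_id.add_const t)).mul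
    (Complex.continuous_conj.measurable.comp hm)).aestronglyMeasurable) (Eventually.of_forall fun x ↦ ?_)
  by_cases hx : x ∈ Icc (-a) a
  · rw [indicator_of_mem hx, norm_mul, Complex.norm_conj]
    exact mul_le_mul (hb _) (hb _) (norm_nonneg _) hS
  · rw [hz x hx, map_zero, mul_zero, norm_zero, indicator_of_notMem hx]

/-- **Twisted increments through the shift pairing**: for a bounded measurable `u` vanishing off
`[-a, a]`, `ω ∈ ℂ`, `t ∈ ℝ`: `D^ω_t(u) = (1 + |ω|²)‖u‖₂² − 2 Re(ω̄ ∫ u(x+t) conj u(x) dx)`. -/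
theorem weilTwistIncrement_eq_of_window (hm : Measurable u) (hz : ∀ x, x ∉ Icc (-a) a → u x = 0)
    (hb : ∀ x, ‖u x‖ ≤ S) (ω : ℂ) (t : ℝ) :
    weilTwistIncrement ω u t =
      (1 + ‖ω‖ ^ 2) * (∫ x, ‖u x‖ ^ 2) - 2 * (conj ω * ∫ x, u (x + t) * conj (u x)).re := by
  have hN : Integrable fun x ↦ ‖u x‖ ^ 2 := integrable_norm_sq_window hm hz hb
  have hNt : Integrable fun x ↦ ‖u (x + t)‖ ^ 2 := hN.comp_add_right t
  have hP := integrable_shift_mul_conj hm hz hb t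
  have hpt : ∀ x, ‖u (x + t) - ω * u x‖ ^ 2 =
      ‖u (x + t)‖ ^ 2 + ‖ω‖ ^ 2 * ‖u x‖ ^ 2 - 2 * (conj ω * (u (x + t) * conj (u x))).re := by
    intro x
    rw [norm_sub_sq_complex, norm_mul, mul_pow, map_mul]
    congr 2
    congr 1
    ring
  have h3 : Integrable fun x ↦ 2 * (conj ω * (u (x + t) * conj (u x))).re := (hP.const_mul _).re.const_mul 2
  have h12 : Integrable fun x ↦ ‖u (x + t)‖ ^ 2 + ‖ω‖ ^ 2 * ‖u x‖ ^ 2 := hNt.add (hN.const_mul _)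
  unfold weilTwistIncrement
  simp_rw [hpt]
  rw [integral_sub h12 h3, integral_add hNt (hN.const_mul _), integral_const_mul, integral_const_mul,
    integral_add_right_eq_self (fun x ↦ ‖u x‖ ^ 2) t]
  have hre : ∫ x, (conj ω * (u (x + t) * conj (u x))).re = (conj ω * ∫ x, u (x + t) * conj (u x)).re := by
    have h1 := integral_re (hP.const_mul (conj ω))
    simp only [RCLike.re_to_complex] at h1
    rw [h1, integral_const_mul]
  rw [hre]
  ring

/-! ## The window-level identity for an even character -/

/-- The parity-`0` densities are the `ζ` ones. -/
private theorem weilArchDensityPar_zero'' : weilArchDensityPar 0 = weilArchDensity := by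
  funext t
  simp only [weilArchDensityPar, weilArchDensity, Nat.cast_zero, sub_zero, one_div_mul_eq_div]

/-- The parity-`0` killing density is the `ζ` one. -/
private theorem weilKillingDensityPar_zero'' (t : ℝ) :
    weilKillingDensityPar 0 t = (Real.exp (t / 2) - 1) / (2 * Real.sinh t) := by
  simp only [weilKillingDensityPar, Nat.cast_zero, sub_zero, one_div_mul_eq_div]

/-- **The twisted window form of an EVEN character through the `ζ` window form and the shift pairing**:
for `a_χ = 0` and a bounded measurable `u` vanishing off `[-a, a]`, with `h(t) = ∫ u(x+t) conj u(x) dx`,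
`𝓔^χ_a(u) − M^χ_a‖u‖₂² = weilWindowForm a u − P(u) + 2Σ_{log k<2a} Λ(k)k^{-1/2} Re((1 − χ(k))h(log k)) + (log q)‖u‖₂²`. -/
theorem twistedWindowForm_eq_of_even (χ : DirichletCharacter ℂ q) (heven : charParity χ = 0)
    (hm : Measurable u) (hz : ∀ x, x ∉ Icc (-a) a → u x = 0) (hb : ∀ x, ‖u x‖ ≤ S) :
    weilDirichletEnergyChar χ a u - weilMarkovConstantChar χ a * ∫ x, ‖u x‖ ^ 2 =
      weilWindowForm a u - weilPoleForm u +
        2 * (∑ k ∈ weilPrimeIndex a, (Λ k : ℝ) / Real.sqrt k *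
          ((1 - χ (k : ZMod q)) * ∫ x, u (x + Real.log k) * conj (u x)).re) +
        Real.log q * ∫ x, ‖u x‖ ^ 2 := by
  have htw : ∀ k : ℕ, weilTwistIncrement (conj (χ (k : ZMod q))) u (Real.log k) =
      (1 + ‖χ (k : ZMod q)‖ ^ 2) * (∫ x, ‖u x‖ ^ 2) -
        2 * (χ (k : ZMod q) * ∫ x, u (x + Real.log k) * conj (u x)).re := fun k ↦ by
    rw [weilTwistIncrement_eq_of_window hm hz hb, Complex.norm_conj, Complex.conj_conj]
  have hpl : ∀ k : ℕ, weilIncrement u (Real.log k) =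
      2 * (∫ x, ‖u x‖ ^ 2) - 2 * (∫ x, u (x + Real.log k) * conj (u x)).re := fun k ↦ by
    have h := weilTwistIncrement_eq_of_window hm hz hb 1 (Real.log k)
    rw [show weilTwistIncrement 1 u (Real.log k) = weilIncrement u (Real.log k) by
      simp [weilTwistIncrement, weilIncrement], map_one, one_mul, norm_one] at h
    rw [h]; ring
  have hre : ∀ k : ℕ, ((1 - χ (k : ZMod q)) * ∫ x, u (x + Real.log k) * conj (u x)).re =
      (∫ x, u (x + Real.log k) * conj (u x)).re -
        (χ (k : ZMod q) * ∫ x, u (x + Real.log k) * conj (u x)).re := by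
    intro k; rw [sub_mul, one_mul, Complex.sub_re]
  unfold weilDirichletEnergyChar weilMarkovConstantChar weilWindowForm weilDirichletEnergy weilMarkovConstant
  rw [heven, weilArchDensityPar_zero'']
  simp_rw [htw, hpl, hre, weilKillingDensityPar_zero'']
  set N2 : ℝ := ∫ x, ‖u x‖ ^ 2
  have h1 : ∑ k ∈ weilPrimeIndex a, (Λ k : ℝ) / Real.sqrt k *
      ((1 + ‖χ (k : ZMod q)‖ ^ 2) * N2 - 2 * (χ (k : ZMod q) * ∫ x, u (x + Real.log k) * conj (u x)).re) =
      N2 * (∑ k ∈ weilPrimeIndex a, (Λ k : ℝ) / Real.sqrt k * (1 + ‖χ (k : ZMod q)‖ ^ 2)) -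
        2 * ∑ k ∈ weilPrimeIndex a, (Λ k : ℝ) / Real.sqrt k *
          (χ (k : ZMod q) * ∫ x, u (x + Real.log k) * conj (u x)).re := by
    rw [Finset.mul_sum, Finset.mul_sum, ← Finset.sum_sub_distrib]
    exact Finset.sum_congr rfl fun k _ ↦ by ring
  have h2 : ∑ k ∈ weilPrimeIndex a, (Λ k : ℝ) / Real.sqrt k *
      (2 * N2 - 2 * (∫ x, u (x + Real.log k) * conj (u x)).re) =
      2 * N2 * (∑ k ∈ weilPrimeIndex a, (Λ k : ℝ) / Real.sqrt k) -
        2 * ∑ k ∈ weilPrimeIndex a, (Λ k : ℝ) / Real.sqrt k * (∫ x, u (x + Real.log k) * conj (u x)).re := by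
    rw [Finset.mul_sum, Finset.mul_sum, ← Finset.sum_sub_distrib]
    exact Finset.sum_congr rfl fun k _ ↦ by ring
  have h3 : ∑ k ∈ weilPrimeIndex a, (Λ k : ℝ) / Real.sqrt k *
      ((∫ x, u (x + Real.log k) * conj (u x)).re -
        (χ (k : ZMod q) * ∫ x, u (x + Real.log k) * conj (u x)).re) =
      (∑ k ∈ weilPrimeIndex a, (Λ k : ℝ) / Real.sqrt k * (∫ x, u (x + Real.log k) * conj (u x)).re) -
        ∑ k ∈ weilPrimeIndex a, (Λ k : ℝ) / Real.sqrt k *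
          (χ (k : ZMod q) * ∫ x, u (x + Real.log k) * conj (u x)).re := by
    rw [← Finset.sum_sub_distrib]
    exact Finset.sum_congr rfl fun k _ ↦ by ring
  rw [h1, h2, h3]
  ring

/-! ## The entry theorem -/

section Pairing

variable (s : Finset ℤ) (c : ℤ → ℂ)

/-- The real pairing against a complex kernel of the form `z·P(m,n) + conj(z·P(n,m))` is twice the real part
of `z` times the sesquilinear pairing `Σ_m Σ_n c_m conj(c_n) P(m,n)`. -/
private theorem sum_sum_re_herm (z : ℂ) (P : ℤ → ℤ → ℂ) :
    ∑ n ∈ s, ∑ m ∈ s, (conj (c n) * c m * (z * P m n + conj (z * P n m))).re =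
      2 * (z * ∑ m ∈ s, ∑ n ∈ s, c m * conj (c n) * P m n).re := by
  have hA : ∑ n ∈ s, ∑ m ∈ s, (conj (c n) * c m * (z * P m n)).re =
      (z * ∑ m ∈ s, ∑ n ∈ s, c m * conj (c n) * P m n).re := by
    rw [Finset.sum_comm]
    simp only [Finset.mul_sum, Complex.re_sum]
    refine Finset.sum_congr rfl fun m _ ↦ Finset.sum_congr rfl fun n _ ↦ ?_
    congr 1
    ring
  have hB : ∑ n ∈ s, ∑ m ∈ s, (conj (c n) * c m * conj (z * P n m)).re =
      (z * ∑ m ∈ s, ∑ n ∈ s, c m * conj (c n) * P m n).re := by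
    simp only [Finset.mul_sum, Complex.re_sum]
    refine Finset.sum_congr rfl fun n _ ↦ Finset.sum_congr rfl fun m _ ↦ ?_
    rw [show conj (c n) * c m * conj (z * P n m) = conj (z * (c n * conj (c m) * P n m)) by
      simp only [map_mul, Complex.conj_conj]; ring, Complex.conj_re]
  simp only [mul_add, Complex.add_re, Finset.sum_add_distrib]
  rw [hA, hB]
  ring

/-- Three finite sums commute: `Σ_n Σ_m Σ_k = Σ_k Σ_n Σ_m`. -/
private theorem sum_sum_sum_comm (t : Finset ℕ) (f : ℕ → ℤ → ℤ → ℝ) :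
    ∑ n ∈ s, ∑ m ∈ s, ∑ k ∈ t, f k n m = ∑ k ∈ t, ∑ n ∈ s, ∑ m ∈ s, f k n m := by
  calc ∑ n ∈ s, ∑ m ∈ s, ∑ k ∈ t, f k n m
      = ∑ n ∈ s, ∑ k ∈ t, ∑ m ∈ s, f k n m := Finset.sum_congr rfl fun n _ ↦ Finset.sum_comm
    _ = ∑ k ∈ t, ∑ n ∈ s, ∑ m ∈ s, f k n m := Finset.sum_comm

end Pairing

/-- **ENTRY THEOREM for an even character (complex values allowed)**: for `a_χ = 0`, `a > 0`, every finite
set of modes `s` and coefficients `c`,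
`𝓔^χ_a(Σ c_nχ_n) − M^χ_a‖Σ c_nχ_n‖₂² = Σ_n Σ_m Re(conj c_n · c_m · twistedGramCoeffC χ a n m)`. -/
theorem twistedWindowForm_sum_smul_chi_eq_twistedGramCoeffC (χ : DirichletCharacter ℂ q)
    (heven : charParity χ = 0) (ha : 0 < a) (s : Finset ℤ) (c : ℤ → ℂ) :
    weilDirichletEnergyChar χ a (∑ n ∈ s, c n • chi a n) -
        weilMarkovConstantChar χ a * ∫ x, ‖(∑ n ∈ s, c n • chi a n) x‖ ^ 2 =
      ∑ n ∈ s, ∑ m ∈ s, (conj (c n) * c m * twistedGramCoeffC χ a n m).re := by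
  rw [twistedWindowForm_eq_of_even χ heven (measurable_sum_smul_chi _ _)
    (fun x hx ↦ sum_smul_chi_eq_zero _ _ hx) (fun x ↦ norm_sum_smul_chi_le _ _ x),
    weilWindowForm_sum_smul_chi_eq_gramCoeff ha, weilPoleForm_sum_smul_chi ha,
    integral_norm_sq_sum_smul_chi' ha]
  have hk : ∀ k ∈ weilPrimeIndex a, 0 ≤ Real.log k ∧ Real.log k ≤ 2 * a := fun k hk ↦
    ⟨Real.log_natCast_nonneg k, (mem_weilPrimeIndex.1 hk).le⟩
  have hP : (∑ n ∈ s, ∑ m ∈ s, (conj (c n) * c m).re *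
      ((-1 : ℝ) ^ (n + m) * (4 / a) * (Real.exp (a / 2) - Real.exp (-(a / 2))) ^ 2 *
        (1 - 4 * (π * n / a) * (π * m / a)) / ((1 + 4 * (π * n / a) ^ 2) * (1 + 4 * (π * m / a) ^ 2)))) =
      ∑ n ∈ s, ∑ m ∈ s, (conj (c n) * c m).re * polarCoeff a n m := rfl
  -- the shift pairings of the trigonometric window at the prime lengths
  set S : ℕ → ℂ := fun k ↦ ∑ m ∈ s, ∑ n ∈ s, c m * conj (c n) * shiftCoeff a (Real.log k) m n with hSdef
  have hSsum : (∑ k ∈ weilPrimeIndex a, (Λ k : ℝ) / Real.sqrt k *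
      ((1 - χ (k : ZMod q)) * ∫ x, (∑ n ∈ s, c n • chi a n) (x + Real.log k) *
        conj ((∑ n ∈ s, c n • chi a n) x)).re) =
      ∑ k ∈ weilPrimeIndex a, (Λ k : ℝ) / Real.sqrt k * ((1 - χ (k : ZMod q)) * S k).re := by
    refine Finset.sum_congr rfl fun k hk' ↦ ?_
    rw [integral_shift_mul_conj_sum_smul_chi ha s c (hk k hk').1 (hk k hk').2]
  rw [hP, hSsum]
  -- the right-hand side, unfolded and split into the same four pieces
  have e : ∀ n m : ℤ, (conj (c n) * c m * twistedGramCoeffC χ a n m).re =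
      ((conj (c n) * c m).re * gramCoeff a n m - (conj (c n) * c m).re * polarCoeff a n m +
          (conj (c n) * c m).re * (if n = m then Real.log q else 0)) +
        ∑ k ∈ weilPrimeIndex a, (Λ k : ℝ) / Real.sqrt k *
          (conj (c n) * c m * ((1 - χ (k : ZMod q)) * shiftCoeff a (Real.log k) m n +
            conj ((1 - χ (k : ZMod q)) * shiftCoeff a (Real.log k) n m))).re := by
    intro n m
    unfold twistedGramCoeffC
    rw [mul_add, Complex.add_re, Complex.re_mul_ofReal, Finset.mul_sum, Complex.re_sum]
    congr 1
    · ring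
    · refine Finset.sum_congr rfl fun k _ ↦ ?_
      rw [show conj (c n) * c m * ((((Λ k : ℝ) / Real.sqrt k : ℝ) : ℂ) *
          ((1 - χ (k : ZMod q)) * shiftCoeff a (Real.log k) m n +
            conj ((1 - χ (k : ZMod q)) * shiftCoeff a (Real.log k) n m))) =
          (((Λ k : ℝ) / Real.sqrt k : ℝ) : ℂ) * (conj (c n) * c m *
            ((1 - χ (k : ZMod q)) * shiftCoeff a (Real.log k) m n +
              conj ((1 - χ (k : ZMod q)) * shiftCoeff a (Real.log k) n m))) by ring,
        Complex.re_ofReal_mul]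
  have hR : ∑ n ∈ s, ∑ m ∈ s, (conj (c n) * c m * twistedGramCoeffC χ a n m).re =
      (∑ n ∈ s, ∑ m ∈ s, (conj (c n) * c m).re * gramCoeff a n m) -
        (∑ n ∈ s, ∑ m ∈ s, (conj (c n) * c m).re * polarCoeff a n m) +
        (∑ n ∈ s, ∑ m ∈ s, (conj (c n) * c m).re * (if n = m then Real.log q else 0)) +
        ∑ k ∈ weilPrimeIndex a, (Λ k : ℝ) / Real.sqrt k *
          ∑ n ∈ s, ∑ m ∈ s, (conj (c n) * c m * ((1 - χ (k : ZMod q)) * shiftCoeff a (Real.log k) m n +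
            conj ((1 - χ (k : ZMod q)) * shiftCoeff a (Real.log k) n m))).re := by
    rw [Finset.sum_congr rfl fun n _ ↦ Finset.sum_congr rfl fun m _ ↦ e n m]
    simp only [Finset.sum_add_distrib, Finset.sum_sub_distrib]
    congr 1
    rw [sum_sum_sum_comm]
    refine Finset.sum_congr rfl fun k _ ↦ ?_
    rw [Finset.mul_sum]
    refine Finset.sum_congr rfl fun n _ ↦ ?_
    rw [Finset.mul_sum]
  have hherm : ∀ k : ℕ, ∑ n ∈ s, ∑ m ∈ s, (conj (c n) * c m *
      ((1 - χ (k : ZMod q)) * shiftCoeff a (Real.log k) m n +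
        conj ((1 - χ (k : ZMod q)) * shiftCoeff a (Real.log k) n m))).re =
      2 * ((1 - χ (k : ZMod q)) * S k).re := fun k ↦ by
    rw [sum_sum_re_herm]
  have hQ : ∑ n ∈ s, ∑ m ∈ s, (conj (c n) * c m).re * (if n = m then Real.log q else 0) =
      Real.log q * ∑ n ∈ s, ∑ m ∈ s, (conj (c n) * c m).re * (if n = m then (1 : ℝ) else 0) := by
    rw [Finset.mul_sum]
    refine Finset.sum_congr rfl fun n _ ↦ ?_
    rw [Finset.mul_sum]
    refine Finset.sum_congr rfl fun m _ ↦ ?_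
    split_ifs <;> ring
  have h2 : ∑ k ∈ weilPrimeIndex a, (Λ k : ℝ) / Real.sqrt k * (2 * ((1 - χ (k : ZMod q)) * S k).re) =
      2 * ∑ k ∈ weilPrimeIndex a, (Λ k : ℝ) / Real.sqrt k * ((1 - χ (k : ZMod q)) * S k).re := by
    rw [Finset.mul_sum]
    exact Finset.sum_congr rfl fun k _ ↦ by ring
  rw [hR]
  simp_rw [hherm]
  rw [hQ, h2]
  ring

/-! ## The certificate interface for an even character -/

/-- **A hermitian PSD certificate of `twistedGramCoeffC χ a` on every `modes N` gives the rung**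
(`q ≠ 1`, `a > 0`, `a_χ = 0`): if `Σ_{n,m} Re(conj c_n · c_m · G^χ(n,m)) ≥ 0` for every `N` and every
`c : ℤ → ℂ`, then `WeilPositivityOnChar χ a`.  (A kernel-side certificate realifies the hermitian matrix.) -/
theorem weilPositivityOnChar_of_twistedGramCoeffC_psd (hq : q ≠ 1) (χ : DirichletCharacter ℂ q)
    (heven : charParity χ = 0) (ha : 0 < a)
    (hpsd : ∀ (N : ℕ) (c : ℤ → ℂ),
      0 ≤ ∑ n ∈ modes N, ∑ m ∈ modes N, (conj (c n) * c m * twistedGramCoeffC χ a n m).re) :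
    WeilPositivityOnChar χ a :=
  weilPositivityOnChar_of_twistedWindowForm_sum_chi_nonneg hq χ ha fun N c ↦ by
    rw [twistedWindowForm_sum_smul_chi_eq_twistedGramCoeffC χ heven ha]
    exact hpsd N c

end Summit.Ventures.WeilGRH

end
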